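/-
Copyright (c) 2026 the pub-hodgecm-mathlib formalisation cell (harness21).  Prover seat hodgecm-mathlib-K2E1-p11 (g6), Track B ∕ K2-LIT, h413 = `stmt-HodgeConjecture-24833`,
R90-TF section S8 «ContSpec-n½», the `hsrc` supplier estate, census `R90/S8/CENSUS-UnfoldingLetterFree.K2E1-p11-g6.md` f7bfa6fc755d5846 item (d1) (S8 dealer R90-CS-plan (g4),
S8-R266 (6) «(d) next»): THE GOOD SPLIT PLACE READING of the pure-tensor letter `hΩ` — at a split good place `v` (places `w ≠ w̄ = c⁻¹w` above it) where the base point is `1`,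
the ★ split Iwasawa brick (R90-C10-p07, `GL₃(L_w)`) transported along ★ `localPiSplitEquiv : U(Φ₃)(L⁺_v) ≅ GL₃(L_w)` to ★ p864965's `localPi` readings: the «on» reading with
local units `t_w = b₀₀ = α₂`, `t_w̄ = c⁻¹_*(b₂₂⁻¹) = c⁻¹_*(α₁)` — the two Gindikin–Karpelevich torus entries.
-/
import Summits.HodgeConjecture.HodgeConjecture.Theorems.K2E1ChiGoodInertReadingU3          -- ★ p865184 (this seat): brings ★ p865059 dictionary, ★ p865012 readings, ★ p864965 assembly (`apply_diag_ne_zero_of_blockTriangular`), ★ `antidiagOne_eq_over`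
import Summits.HodgeConjecture.HodgeConjecture.Theorems.K2E1BigCellIwasawaTorusEntrySplitU3  -- ★ (R90-C10-p07): `exists_iwasawa_torusEntries_split` (the `GL₃` Iwasawa torus entries, ANY `δ₁`)
import Literature.NumberTheory.Automorphic.UnitaryGroupSplitPlace                          -- ★ `localPiSplitEquiv`, `splitInv_apply_self`, `splitInv_apply_galInv`, `splitHat`, `GLn.contragredient`, `PlacesOver.eq_or_eq_galInv`, `localPiSplitEquiv_symm_mem_localInt_iff`
import Literature.NumberTheory.Automorphic.LocalUnitaryIntegralLevel                       -- ★ `placeForm_antidiagOne`, `isUnit_placeForm_antidiagOne`, `unit_placeForm_antidiagOne_mem_glInt`, `antidiagOne_map_transpose`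
import HarnessLib

/-!
# K2·E1 ∕ R90·S8 — `K2E1ChiGoodSplitReadingU3`: THE GOOD SPLIT PLACE READING OF `hΩ` — at a split good place with base-point component `1`, `evalPlace v (U x) = β·κ` in `localPi v`
# with `β` upper triangular at both places above `v`, `κ` in `K(1)` at both, and local `(0,0)`-units `t_w = α₂(p)`, `t_{c⁻¹w} = c⁻¹_*(α₁(p))` — the ★ `GL₃(L_w)` Iwasawa torus entries

Cell `pub/hodgecm-mathlib`, crux h413 = `stmt-HodgeConjecture-24833`, route of record `HCCMUnconditional`; R90-TF section S8 «ContSpec-n½», road R2-χ₃ ((V)∕(R)′ OF RECORD row `hsrc`, the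
pure-tensor letter `hΩ` of ★ p864821 `hsrc_of_record_at_basePoint_of_core`; ★ p864965 `hΩ_of_localReadings` reduces it to per-place readings — `S₀` ★ p865059 + ★ p865233, inert ★ p865184,
SPLIT: this file).  THEOREMS ONLY (no `def`, no `instance`, no `notation`, no named-fact hypothesis, no `sorry`; default heartbeats); lane `--supports stmt-HodgeConjecture-24833 --as helper`
(count-neutral).  Closes no socket.

THE MATHEMATICS ([Rogawski1990] §4.7 p. 66, §4.5 p. 45; [Bump1997] Prop. 4.5.2; [PlatonovRapinchuk1994] §5.1; [Mok2014] §1 p. 5).  At a place `v` of `L⁺` SPLIT in `L` (`w ∣ v` with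
`c·w ≠ w`; the other place is `w̄ = c⁻¹w`) the projection `u ↦ u_w` is `U(Φ₃)(L⁺_v) ≅ GL₃(L_w)` (★ `localPiSplitEquiv`), with inverse `g ↦ (g, c⁻¹_*((Φ₃ g Φ₃)⁻¹)ᵀ)` (★ `splitInv`,
`splitHat`, `contragredient`).  With base-point component `1`, the `w`-component of `U(x) = (ι(w₀)·u((0,Ψ^∞(x₀,x₁)),θ(0,x₂)))_f·b₁` is `Φ₃·u(X_w, −σX_w?, Z_w)` — precisely `Φ₃·n(q)` for the
brick's unipotent `n(q) = (1 x z; 0 1 y; 0 0 1)` in the Gindikin–Karpelevich base coordinates `x = q₀ + δ_w q₁ = X_w`, `y = −(q₀ − δ_w q₁) = −σX_w`, `z = δ_w q₂ − ½(q₀+δ_wq₁)(q₀−δ_wq₁) = Z_w`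
at `q = ι_w(x|_v) := (ι_w x₀|_v, ι_w x₁|_v, ι_w x₂|_v) ∈ L_w³`, `δ_w` the image of `δ` in `L_w` (§2, ★ p865012 ∘ ★ dictionary).  The ★ brick `exists_iwasawa_torusEntries_split` factorises
`Φ₃·n(q) = b(q)·k(q)` with `b` upper triangular, `k ∈ GL₃(𝒪_w)`, `b₂₂ = α₁(q)⁻¹`, `b₀₀ = α₂(q)`, `‖α₁‖·A = 1`, `‖α₂‖·B = 1`.  TRANSPORT (§1): `β := splitInv b`, `κ := splitInv k` lie in
`U(Φ₃)(L⁺_v)` (★ `splitInv_mem`), `U(x)_v = β·κ` because both have `w`-component `b·k` (★ the projection is injective), `κ ∈ U(𝒪_v)` (★ `localPiSplitEquiv_symm_mem_localInt_iff`, `Φ₃`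
hyperspecial ★ `unit_placeForm_antidiagOne_mem_glInt`) hence in `K_{w'}(1)` at both `w'` (★ p864759 `glInt_le_valuedCongruenceSubgroup_one`); `β_w = b` is upper triangular and
`β_{w̄} = c⁻¹_*((Φ₃bΦ₃)⁻¹)ᵀ` has entries `c⁻¹_*((b⁻¹)_{rev j, rev i})` — upper triangular (as `b⁻¹` is), with `(0,0)`-entry `c⁻¹_*((b⁻¹)₂₂) = c⁻¹_*(b₂₂⁻¹) = c⁻¹_*(α₁(q))`.  So the «on» reading
of ★ `hΩ_of_localReadings` holds at `v` with `t_w = α₂(q)`, `t_{w̄} = c⁻¹_*(α₁(q))` — the two Gindikin–Karpelevich torus entries (norms `B⁻¹`, `A⁻¹`), on which an unramified pair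
`(χ₁,w, χ₁,w̄)` reads ★ `hsp_of_torusEntries`' split token once the degree-one bridge `L⁺_v ≅ L_w` rewrites `A, B, α₁, α₂` in `L⁺_v`-coordinates (next file (d2)).
* §1 generic `GL₃`: `exists_heisGL`, `inv_apply_two_two_of_blockTriangular`, `coe_antidiag_mul_mul_antidiag_apply`; the form at a split place: `antidiag_map_transpose`, `isUnit_placeForm_antidiag`,
  `coe_unit_placeForm_antidiag`, `unit_placeForm_antidiag_mem_glInt`, `unit_placeForm_antidiag_inv`, `coe_splitHat_apply` (entries `(b⁻¹)_{rev j, rev i}`), `blockTriangular_splitHat`.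
* §2 **`coe_evalPlace_bigCell_eq_antidiag_mul_heis_of_evalPlace_eq_one`** — the `w`-component IS `Φ₃·n(ι_w(x|_v))`.
* §3 HEAD **`exists_goodSplit_reading`** — `∃ α₁ α₂` (the brick's torus-entry functions over `L_w`, with their unguarded (α)-letters) such that `∀ x` the «on» reading holds with `t_w = α₂(ι_w x|_v)`,
  `(t_{w̄} : L_{w̄}) = c⁻¹_*(α₁(ι_w x|_v))`.
HONEST LABEL: HC_CM is proved only modulo the 7 printed citations (2 remaining named inputs: hLiu418 = `stmt-HodgeConjecture-24832`, h413 = `stmt-HodgeConjecture-24833`) until rung 0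
closes; REL ≠ ★ ≠ BUILT; unconditional; asserts no named fact, closes no socket; the split TOKEN `hsp` still needs (d2) (the `L⁺_v`-coordinate bridge); count-neutral.

## References
* [Rogawski1990] J. D. Rogawski, *Automorphic Representations of Unitary Groups in Three Variables*, Ann. of Math. Stud. 123 (1990), §4.5 p. 45, §4.7 p. 66.
* [Bump1997] D. Bump, *Automorphic Forms and Representations* (1997), Prop. 4.5.2.
* [PlatonovRapinchuk1994] V. Platonov, A. Rapinchuk, *Algebraic Groups and Number Theory* (1994), §5.1.
* [Mok2014] C. P. Mok, *Endoscopic classification of representations of quasi-split unitary groups*, Mem. AMS 235 (2015), §1 Notation p. 5.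
-/

set_option autoImplicit false
set_option linter.dupNamespace false  -- the mandated namespace repeats the summit's segment (`HodgeConjecture.HodgeConjecture`)

noncomputable section

open NumberField IsDedekindDomain Filter Set Function
open scoped NNReal Matrix
open Literature.NumberTheory.GaloisRepresentations Literature.NumberTheory.GaloisRepresentations.HeckeCharacter
open Literature.NumberTheory.GaloisRepresentations.IsNonarchimedeanLocalField
open Literature.NumberTheory.Automorphic Literature.NumberTheory.Automorphic.UnitaryGroup AdelicGroupData
open Literature.NumberTheory.Automorphic.Arthur2013.Leaves.TECR
open Summit.HodgeConjecture.HodgeConjecture.Cruxes.H413.K2E1ChiMidBlockUnfoldingLetterFreeU3 (apply_diag_ne_zero_of_blockTriangular)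
open Summit.HodgeConjecture.HodgeConjecture.Cruxes.H413.K2E1ChiFinReadingEntriesU3 (coe_evalPlace_finPart_weylLongU_mul_heisChart_mul_of_evalPlace_eq_one)
open Summit.HodgeConjecture.HodgeConjecture.Cruxes.H413.K2E1ChiBadPlaceReadingU3 (snd_quadraticFiniteAdeleMap_apply_placesOver conjAdele_snd_apply_placesOver)
open Summit.HodgeConjecture.HodgeConjecture.Cruxes.H413.K2E1IntertwiningFiniteHeightDictionaryU3 (heisZ_snd_apply_placesOver)
open Summit.HodgeConjecture.HodgeConjecture.Cruxes.H413.K2E1BigCellIwasawaTorusEntrySplitU3 (exists_iwasawa_torusEntries_split)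
open Summit.HodgeConjecture.HodgeConjecture.Cruxes.H413.K2E1FinAdelicBorelLevelLocalGlobalU3 (glInt_le_valuedCongruenceSubgroup_one)

namespace Summit.HodgeConjecture.HodgeConjecture.Cruxes.H413.K2E1ChiGoodSplitReadingU3

/-! ## §1 Generic `GL₃` plumbing, and the form `Φ₃` at a split place -/

section Generic

variable {K : Type*} [Field K]

/-- The upper unitriangular `(1 x z; 0 1 y; 0 0 1) ∈ GL₃(K)` exists (inverse `(1 −x xy−z; 0 1 −y; 0 0 1)`). [cite: Bump1997, Prop. 4.5.2] -/
theorem exists_heisGL (x y z : K) : ∃ n : GL (Fin 3) K, (n : Matrix (Fin 3) (Fin 3) K) = !![1, x, z; 0, 1, y; 0, 0, 1] := by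
  refine ⟨⟨!![1, x, z; 0, 1, y; 0, 0, 1], !![1, -x, x * y - z; 0, 1, -y; 0, 0, 1], ?_, ?_⟩, rfl⟩
  · rw [Matrix.mul_fin_three]
    ext i j
    fin_cases i <;> fin_cases j <;> (simp; try ring)
  · rw [Matrix.mul_fin_three]
    ext i j
    fin_cases i <;> fin_cases j <;> (simp; try ring)

/-- For an invertible upper triangular `3 × 3` matrix, `(b⁻¹)₂₂ = (b₂₂)⁻¹` (the last row of `b·b⁻¹ = 1`). [folklore] -/
theorem inv_apply_two_two_of_blockTriangular (b : GL (Fin 3) K) (hb : (b : Matrix (Fin 3) (Fin 3) K).BlockTriangular id) :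
    ((b⁻¹ : GL (Fin 3) K) : Matrix (Fin 3) (Fin 3) K) 2 2 = ((b : Matrix (Fin 3) (Fin 3) K) 2 2)⁻¹ := by
  have h20 : (b : Matrix (Fin 3) (Fin 3) K) 2 0 = 0 := hb (show (0 : Fin 3) < 2 by decide)
  have h21 : (b : Matrix (Fin 3) (Fin 3) K) 2 1 = 0 := hb (show (1 : Fin 3) < 2 by decide)
  have hmul : ((b : Matrix (Fin 3) (Fin 3) K) * ((b⁻¹ : GL (Fin 3) K) : Matrix (Fin 3) (Fin 3) K)) 2 2 = 1 := by
    rw [← Units.val_mul, mul_inv_cancel, Units.val_one, Matrix.one_apply_eq]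
  rw [Matrix.mul_apply, Fin.sum_univ_three, h20, h21, zero_mul, zero_mul, zero_add, zero_add] at hmul
  exact eq_inv_of_mul_eq_one_right hmul

/-- `(Φ₃ · M · Φ₃)_{ij} = M_{rev i, rev j}`. [folklore] -/
theorem coe_antidiag_mul_mul_antidiag_apply (M : Matrix (Fin 3) (Fin 3) K) (i j : Fin 3) :
    (!![(0 : K), 0, 1; 0, 1, 0; 1, 0, 0] * M * !![(0 : K), 0, 1; 0, 1, 0; 1, 0, 0]) i j = M i.rev j.rev := by
  have hM : M = !![M 0 0, M 0 1, M 0 2; M 1 0, M 1 1, M 1 2; M 2 0, M 2 1, M 2 2] := Matrix.eta_fin_three M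
  rw [hM, Matrix.mul_fin_three, Matrix.mul_fin_three]
  fin_cases i <;> fin_cases j <;> simp

end Generic

section SplitForm

variable (L : Type) [Field L] [NumberField L] [IsCMField L] {v : HeightOneSpectrum (𝓞 ↥(maximalRealSubfield L))}

omit [NumberField L] [IsCMField L] in
/-- `Φ₃` over `L` is hermitian for any involution: `((Φ₃).map c)ᵀ = Φ₃` (★ `antidiagOne_map_transpose` along ★ `antidiagOne_eq_over`). [cite: Mok2014, §1 Notation p. 5] -/
theorem antidiag_map_transpose (c : L ≃ₐ[↥(maximalRealSubfield L)] L) :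
    (((StdForm.antidiagonal 3).over L).map c)ᵀ = (StdForm.antidiagonal 3).over L := by
  rw [← antidiagOne_eq_over L 3]
  exact antidiagOne_map_transpose c 3

omit [IsCMField L] in
/-- `Φ₃` is invertible at `w` (★ `isUnit_placeForm_antidiagOne`). [cite: Mok2014, §1 Notation p. 5] -/
theorem isUnit_placeForm_antidiag (w : PlacesOver L v) : IsUnit (placeForm ((StdForm.antidiagonal 3).over L) w.1) := by
  rw [← antidiagOne_eq_over L 3]
  exact isUnit_placeForm_antidiagOne 3 w.1

omit [IsCMField L] in
/-- The matrix of the local form unit is `Φ₃` (★ `placeForm_antidiagOne`, ★ `antidiagonal_three_over`). [cite: Mok2014, §1 Notation p. 5] -/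
theorem coe_unit_placeForm_antidiag (w : PlacesOver L v) :
    (((isUnit_placeForm_antidiag L w).unit : GL (Fin 3) (w.1.adicCompletion L)) : Matrix (Fin 3) (Fin 3) (w.1.adicCompletion L)) = !![(0 : w.1.adicCompletion L), 0, 1; 0, 1, 0; 1, 0, 0] := by
  rw [IsUnit.unit_spec, ← Literature.NumberTheory.QuadraticForms.HermitianUnimodularRamified.antidiagonal_three_over, ← placeForm_antidiagOne, antidiagOne_eq_over]

omit [IsCMField L] in
/-- `Φ₃` is hyperspecial at `w`: the form unit lies in `GL₃(𝒪_w)` (★ `unit_placeForm_antidiagOne_mem_glInt`). [cite: PlatonovRapinchuk1994, §5.1] -/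
theorem unit_placeForm_antidiag_mem_glInt (w : PlacesOver L v) : (isUnit_placeForm_antidiag L w).unit ∈ glInt 3 (w.1.adicCompletion L) := by
  have e : (isUnit_placeForm_antidiag L w).unit = (isUnit_placeForm_antidiagOne (E := L) 3 w.1).unit :=
    Units.ext (by rw [IsUnit.unit_spec, IsUnit.unit_spec, antidiagOne_eq_over])
  rw [e]
  exact unit_placeForm_antidiagOne_mem_glInt 3 w.1

omit [IsCMField L] in
/-- `Φ₃⁻¹ = Φ₃` for the form unit. [folklore] -/
theorem unit_placeForm_antidiag_inv (w : PlacesOver L v) : ((isUnit_placeForm_antidiag L w).unit)⁻¹ = (isUnit_placeForm_antidiag L w).unit := by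
  refine inv_eq_of_mul_eq_one_right (Units.ext ?_)
  rw [Units.val_mul, coe_unit_placeForm_antidiag, Units.val_one, Matrix.mul_fin_three]
  ext i j
  fin_cases i <;> fin_cases j <;> simp

omit [IsCMField L] in
/-- **Entries of `splitHat` at the form `Φ₃`**: `(((Φ₃ b Φ₃)⁻¹)ᵀ)_{ij} = (b⁻¹)_{rev j, rev i}`. [cite: Rogawski1990, §4.7 p. 66] -/
theorem coe_splitHat_apply (w : PlacesOver L v) (b : GL (Fin 3) (w.1.adicCompletion L)) (i j : Fin 3) :
    ((splitHat w (isUnit_placeForm_antidiag L w).unit b : GL (Fin 3) (w.1.adicCompletion L)) : Matrix (Fin 3) (Fin 3) (w.1.adicCompletion L)) i j =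
      ((b⁻¹ : GL (Fin 3) (w.1.adicCompletion L)) : Matrix (Fin 3) (Fin 3) (w.1.adicCompletion L)) j.rev i.rev := by
  rw [splitHat_apply, GLn.coe_contragredient, Matrix.transpose_apply, mul_inv_rev, mul_inv_rev, inv_inv, unit_placeForm_antidiag_inv, ← mul_assoc, Units.val_mul, Units.val_mul,
    coe_unit_placeForm_antidiag]
  exact coe_antidiag_mul_mul_antidiag_apply _ j i

omit [IsCMField L] in
/-- **`splitHat` of an upper triangular matrix is upper triangular** (its entries are `(b⁻¹)_{rev j, rev i}` and `b⁻¹` is upper triangular). [cite: Rogawski1990, §4.7 p. 66] -/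
theorem blockTriangular_splitHat (w : PlacesOver L v) {b : GL (Fin 3) (w.1.adicCompletion L)} (hb : (b : Matrix (Fin 3) (Fin 3) (w.1.adicCompletion L)).BlockTriangular id) :
    ((splitHat w (isUnit_placeForm_antidiag L w).unit b : GL (Fin 3) (w.1.adicCompletion L)) : Matrix (Fin 3) (Fin 3) (w.1.adicCompletion L)).BlockTriangular id := by
  have hbinv : ((b⁻¹ : GL (Fin 3) (w.1.adicCompletion L)) : Matrix (Fin 3) (Fin 3) (w.1.adicCompletion L)).BlockTriangular id := by
    rw [Matrix.coe_units_inv]; exact Matrix.blockTriangular_inv_of_blockTriangular hb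
  intro i j hij
  rw [coe_splitHat_apply]
  exact hbinv (Fin.rev_lt_rev.2 hij)

end SplitForm

/-! ## §2 The `w`-component at a place where the base point is `1` is `Φ₃·n(ι_w(x|_v))` -/

section Component

variable (L : Type) [Field L] [NumberField L] [IsCMField L] (hc : IsCMField.complexConj L * IsCMField.complexConj L = 1)
  {δ : L} (hcδ : IsCMField.complexConj L δ = -δ) (hδ : δ ≠ 0) (v : HeightOneSpectrum (𝓞 ↥(maximalRealSubfield L)))

/-- **THE `w`-COMPONENT IS `Φ₃·n(ι_w(x|_v))`.**  At `w ∣ v` with `((b₁)_v)_w = 1`, the `w`-component of `U(x)` has matrix `(0 0 1; 0 1 y; 1 x z)` with the Gindikin–Karpelevich base coordinates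
`x = ι_w(x₀) + δ_w·ι_w(x₁)`, `y = −(ι_w(x₀) − δ_w·ι_w(x₁))`, `z = δ_w·ι_w(x₂) − ½·x·(ι_w(x₀) − δ_w ι_w(x₁))` (`ι_w = toPlace v w`, `δ_w = δ` in `L_w`) — ★ p865012 ∘ ★ dictionary ∘ ★
`conjLocal_quadraticLocalEquiv`. [cite: Rogawski1990, §1.10 p. 9, §4.5 p. 45] -/
theorem coe_evalPlace_bigCell_of_evalPlace_eq_one (x : Fin 3 → FiniteAdeleRing (𝓞 ↥(maximalRealSubfield L)) ↥(maximalRealSubfield L))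
    (b₁ : ↥(finAdelic (↥(maximalRealSubfield L)) L (IsCMField.complexConj L) 3 ((StdForm.antidiagonal 3).over L))) (w : PlacesOver L v)
    (hb₁ : ((((evalPlace (↥(maximalRealSubfield L)) L (IsCMField.complexConj L) 3 ((StdForm.antidiagonal 3).over L) v b₁ : localPi L (IsCMField.complexConj L) 3 ((StdForm.antidiagonal 3).over L) v) : LocalGLPi L 3 v) w :
      GL (Fin 3) (w.1.adicCompletion L)) : Matrix (Fin 3) (Fin 3) (w.1.adicCompletion L)) = 1) :
    ((((evalPlace (↥(maximalRealSubfield L)) L (IsCMField.complexConj L) 3 ((StdForm.antidiagonal 3).over L) v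
        (finPart (↥(maximalRealSubfield L)) L (IsCMField.complexConj L) 3 ((StdForm.antidiagonal 3).over L)
          ((quasiSplit (↥(maximalRealSubfield L)) L (IsCMField.complexConj L) 3).toAdelic (weylLongU ((IsCMField.complexConj L : L ≃ₐ[↥(maximalRealSubfield L)] L) : L →+* L) (rfl : (StdForm.antidiagonal 3).over L = (StdForm.antidiagonal 3).over L)) *
            ((heisChart hc (((((0 : InfiniteAdeleRing L)), quadraticFiniteAdeleMap ↥(maximalRealSubfield L) L δ (x 0, x 1)) : AdeleRing (𝓞 L) L),
              traceZeroLine ↥(maximalRealSubfield L) L (IsCMField.complexConj L) hcδ hδ ((0, x 2) : AdeleRing (𝓞 ↥(maximalRealSubfield L)) ↥(maximalRealSubfield L))) :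
                ↥(adelicUnipotent ↥(maximalRealSubfield L) L (IsCMField.complexConj L) 3)) : (quasiSplit (↥(maximalRealSubfield L)) L (IsCMField.complexConj L) 3).Adelic)) * b₁) :
        localPi L (IsCMField.complexConj L) 3 ((StdForm.antidiagonal 3).over L) v) : LocalGLPi L 3 v) w : GL (Fin 3) (w.1.adicCompletion L)) : Matrix (Fin 3) (Fin 3) (w.1.adicCompletion L)) =
      !![0, 0, 1;
        0, 1, -(toPlace v w (x 0 v) - algebraMap L (w.1.adicCompletion L) δ * toPlace v w (x 1 v));
        1, toPlace v w (x 0 v) + algebraMap L (w.1.adicCompletion L) δ * toPlace v w (x 1 v),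
          algebraMap L (w.1.adicCompletion L) δ * toPlace v w (x 2 v) - 2⁻¹ * (toPlace v w (x 0 v) + algebraMap L (w.1.adicCompletion L) δ * toPlace v w (x 1 v)) *
            (toPlace v w (x 0 v) - algebraMap L (w.1.adicCompletion L) δ * toPlace v w (x 1 v))] := by
  haveI : Algebra.IsQuadraticExtension ↥(maximalRealSubfield L) L := IsCMField.isQuadraticExtension L
  have hX : quadraticLocalEquiv L v (IsCMField.complexConj L) hcδ hδ (x 0 v, x 1 v) w = toPlace v w (x 0 v) + algebraMap L (w.1.adicCompletion L) δ * toPlace v w (x 1 v) := by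
    rw [quadraticLocalEquiv_apply, Pi.add_apply, Pi.mul_apply, toLocalRing_apply, toLocalRing_apply, Pi.algebraMap_apply, mul_comm]
  have hσX : conjLocal L (IsCMField.complexConj L) v (quadraticLocalEquiv L v (IsCMField.complexConj L) hcδ hδ (x 0 v, x 1 v)) w =
      toPlace v w (x 0 v) - algebraMap L (w.1.adicCompletion L) δ * toPlace v w (x 1 v) := by
    rw [conjLocal_quadraticLocalEquiv, quadraticLocalEquiv_apply, Pi.add_apply, Pi.mul_apply, toLocalRing_apply, toLocalRing_apply, Pi.algebraMap_apply, map_neg]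
    ring
  have h2 : toLocalRing L v (2⁻¹ : v.adicCompletion ↥(maximalRealSubfield L)) w = 2⁻¹ := by
    rw [toLocalRing_apply, map_inv₀, map_ofNat]
  have hZ : (toLocalRing L v (x 2 v) * algebraMap L (LocalRing L v) δ -
      toLocalRing L v 2⁻¹ * (quadraticLocalEquiv L v (IsCMField.complexConj L) hcδ hδ (x 0 v, x 1 v) *
        conjLocal L (IsCMField.complexConj L) v (quadraticLocalEquiv L v (IsCMField.complexConj L) hcδ hδ (x 0 v, x 1 v)))) w =
      algebraMap L (w.1.adicCompletion L) δ * toPlace v w (x 2 v) - 2⁻¹ * (toPlace v w (x 0 v) + algebraMap L (w.1.adicCompletion L) δ * toPlace v w (x 1 v)) *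
        (toPlace v w (x 0 v) - algebraMap L (w.1.adicCompletion L) δ * toPlace v w (x 1 v)) := by
    rw [Pi.sub_apply, Pi.mul_apply, Pi.mul_apply, Pi.mul_apply, hX, hσX, h2, toLocalRing_apply, Pi.algebraMap_apply]
    ring
  rw [coe_evalPlace_finPart_weylLongU_mul_heisChart_mul_of_evalPlace_eq_one L hc _ _ b₁ v w hb₁, conjAdele_snd_apply_placesOver L hcδ hδ x v w,
    snd_quadraticFiniteAdeleMap_apply_placesOver L hcδ hδ x v w, heisZ_snd_apply_placesOver L hcδ hδ (0 : InfiniteAdeleRing L) (x 0) (x 1) (x 2) v w, hZ, hσX, hX]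

end Component

/-! ## §3 HEAD: the split reading -/

section Split

variable (L : Type) [Field L] [NumberField L] [IsCMField L] (hc : IsCMField.complexConj L * IsCMField.complexConj L = 1)
  {δ : L} (hcδ : IsCMField.complexConj L δ = -δ) (hδ : δ ≠ 0) (v : HeightOneSpectrum (𝓞 ↥(maximalRealSubfield L)))

/-- **HEAD — THE GOOD SPLIT PLACE READING OF `hΩ`.**  `v` a finite place of `L⁺` SPLIT in `L` (`w ∣ v`, `c·w ≠ w`), a level `𝔫` with `|𝔫|_{w'} = 1` at every `w' ∣ v`, a base point with
`((b₁)_v)_{w'} = 1`.  THEN there are the ★ brick's torus-entry functions `α₁ α₂ : L_w³ → L_w^×` (with their (α)-letters `‖α₁ q‖·A(q) = 1`, `‖α₂ q‖·B(q) = 1` in the Gindikin–Karpelevich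
base coordinates over `L_w`, `δ₁ := δ_w`) such that for every `x ∈ (𝔸_{L⁺,f})³`, at `q := ι_w(x|_v)`, the «ON» READING of ★ p864965 `hΩ_of_localReadings` holds at `v`: `evalPlace v (U x) = β·κ`, `β`
upper triangular and `κ_{w'} ∈ K_{w'}(|𝔫|_{w'})` at every `w' ∣ v`, with local units `t_{w'} = (β_{w'})₀₀` satisfying `t_w = α₂(q)` and `t_{c⁻¹w} = c⁻¹_*(α₁(q))`.
[cite: Rogawski1990, §4.7 p. 66, §4.5 p. 45] [cite: Bump1997, Prop. 4.5.2] [cite: PlatonovRapinchuk1994, §5.1] -/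
theorem exists_goodSplit_reading (𝔫 : Ideal (𝓞 L)) (w : PlacesOver L v) (hw : IsCMField.complexConj L • w.1 ≠ w.1)
    (h𝔫 : ∀ w' : PlacesOver L v, idealRadius L w'.1 𝔫 = 1)
    (b₁ : ↥(finAdelic (↥(maximalRealSubfield L)) L (IsCMField.complexConj L) 3 ((StdForm.antidiagonal 3).over L)))
    (hb₁ : ∀ w' : PlacesOver L v, ((((evalPlace (↥(maximalRealSubfield L)) L (IsCMField.complexConj L) 3 ((StdForm.antidiagonal 3).over L) v b₁ : localPi L (IsCMField.complexConj L) 3 ((StdForm.antidiagonal 3).over L) v) : LocalGLPi L 3 v) w' :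
      GL (Fin 3) (w'.1.adicCompletion L)) : Matrix (Fin 3) (Fin 3) (w'.1.adicCompletion L)) = 1) :
    ∃ α₁ α₂ : (Fin 3 → w.1.adicCompletion L) → (w.1.adicCompletion L)ˣ,
      -- the (α)-letters of the ★ split brick over `L_w` (`δ₁ := δ_w`)
      (∀ q : Fin 3 → w.1.adicCompletion L, ((normAbs (w.1.adicCompletion L) (α₁ q : w.1.adicCompletion L) : ℝ≥0) : ℝ) *
          max 1 (max ((normAbs (w.1.adicCompletion L) (q 0 + algebraMap L (w.1.adicCompletion L) δ * q 1) : ℝ≥0) : ℝ)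
            ((normAbs (w.1.adicCompletion L) (algebraMap L (w.1.adicCompletion L) δ * q 2 - 2⁻¹ * (q 0 + algebraMap L (w.1.adicCompletion L) δ * q 1) * (q 0 - algebraMap L (w.1.adicCompletion L) δ * q 1)) : ℝ≥0) : ℝ)) = 1) ∧
      (∀ q : Fin 3 → w.1.adicCompletion L, ((normAbs (w.1.adicCompletion L) (α₂ q : w.1.adicCompletion L) : ℝ≥0) : ℝ) *
          max 1 (max ((normAbs (w.1.adicCompletion L) (-(q 0 - algebraMap L (w.1.adicCompletion L) δ * q 1)) : ℝ≥0) : ℝ)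
            ((normAbs (w.1.adicCompletion L) (algebraMap L (w.1.adicCompletion L) δ * q 2 - 2⁻¹ * (q 0 + algebraMap L (w.1.adicCompletion L) δ * q 1) * (q 0 - algebraMap L (w.1.adicCompletion L) δ * q 1) -
              (q 0 + algebraMap L (w.1.adicCompletion L) δ * q 1) * (-(q 0 - algebraMap L (w.1.adicCompletion L) δ * q 1))) : ℝ≥0) : ℝ)) = 1) ∧
      -- the «on» reading at `v`, for every `x`
      ∀ x : Fin 3 → FiniteAdeleRing (𝓞 ↥(maximalRealSubfield L)) ↥(maximalRealSubfield L),
        ∃ (β κ : localPi L (IsCMField.complexConj L) 3 ((StdForm.antidiagonal 3).over L) v) (t : ∀ w' : PlacesOver L v, (w'.1.adicCompletion L)ˣ),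
          (∀ w' : PlacesOver L v, ((((β : localPi L (IsCMField.complexConj L) 3 ((StdForm.antidiagonal 3).over L) v) : LocalGLPi L 3 v) w' : GL (Fin 3) (w'.1.adicCompletion L)) :
            Matrix (Fin 3) (Fin 3) (w'.1.adicCompletion L)).BlockTriangular id) ∧
          (∀ w' : PlacesOver L v, ((κ : localPi L (IsCMField.complexConj L) 3 ((StdForm.antidiagonal 3).over L) v) : LocalGLPi L 3 v) w' ∈ valuedCongruenceSubgroup (Fin 3) (idealRadius L w'.1 𝔫)) ∧
          evalPlace (↥(maximalRealSubfield L)) L (IsCMField.complexConj L) 3 ((StdForm.antidiagonal 3).over L) v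
            (finPart (↥(maximalRealSubfield L)) L (IsCMField.complexConj L) 3 ((StdForm.antidiagonal 3).over L)
              ((quasiSplit (↥(maximalRealSubfield L)) L (IsCMField.complexConj L) 3).toAdelic (weylLongU ((IsCMField.complexConj L : L ≃ₐ[↥(maximalRealSubfield L)] L) : L →+* L) (rfl : (StdForm.antidiagonal 3).over L = (StdForm.antidiagonal 3).over L)) *
                ((heisChart hc (((((0 : InfiniteAdeleRing L)), quadraticFiniteAdeleMap ↥(maximalRealSubfield L) L δ (x 0, x 1)) : AdeleRing (𝓞 L) L),
                  traceZeroLine ↥(maximalRealSubfield L) L (IsCMField.complexConj L) hcδ hδ ((0, x 2) : AdeleRing (𝓞 ↥(maximalRealSubfield L)) ↥(maximalRealSubfield L))) :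
                    ↥(adelicUnipotent ↥(maximalRealSubfield L) L (IsCMField.complexConj L) 3)) : (quasiSplit (↥(maximalRealSubfield L)) L (IsCMField.complexConj L) 3).Adelic)) * b₁) = β * κ ∧
          (∀ w' : PlacesOver L v, ((t w' : (w'.1.adicCompletion L)ˣ) : w'.1.adicCompletion L) =
            ((((β : localPi L (IsCMField.complexConj L) 3 ((StdForm.antidiagonal 3).over L) v) : LocalGLPi L 3 v) w' : GL (Fin 3) (w'.1.adicCompletion L)) : Matrix (Fin 3) (Fin 3) (w'.1.adicCompletion L)) 0 0) ∧
          t w = α₂ (fun i => toPlace v w (x i v)) ∧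
          ((t (PlacesOver.galInv (IsCMField.complexConj L) w) : ((PlacesOver.galInv (IsCMField.complexConj L) w).1.adicCompletion L)) =
            galAdicCompletionMap (IsCMField.complexConj L)⁻¹ (rfl : (IsCMField.complexConj L)⁻¹ • w.1 = (PlacesOver.galInv (IsCMField.complexConj L) w).1)
              (α₁ (fun i => toPlace v w (x i v)) : w.1.adicCompletion L)) := by
  classical
  haveI : Algebra.IsQuadraticExtension ↥(maximalRealSubfield L) L := IsCMField.isQuadraticExtension L
  have hc1 : IsCMField.complexConj L ≠ 1 := IsCMField.complexConj_ne_one L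
  -- the form data at the split place
  have hJ := antidiag_map_transpose L (IsCMField.complexConj L)
  have hJw := isUnit_placeForm_antidiag L w
  have hJi := unit_placeForm_antidiag_mem_glInt L w
  -- the brick: `Φ₃ · n(q) = b(q) · k(q)` in `GL₃(L_w)` with torus entries `α₁, α₂`
  have hn' : ∀ q : Fin 3 → w.1.adicCompletion L, ∃ n : GL (Fin 3) (w.1.adicCompletion L), (n : Matrix (Fin 3) (Fin 3) (w.1.adicCompletion L)) =
      !![1, q 0 + algebraMap L (w.1.adicCompletion L) δ * q 1, algebraMap L (w.1.adicCompletion L) δ * q 2 - 2⁻¹ * (q 0 + algebraMap L (w.1.adicCompletion L) δ * q 1) * (q 0 - algebraMap L (w.1.adicCompletion L) δ * q 1);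
        0, 1, -(q 0 - algebraMap L (w.1.adicCompletion L) δ * q 1); 0, 0, 1] := fun q => exists_heisGL _ _ _
  choose n hn using hn'
  obtain ⟨b, k, α₁, α₂, hbk, hbB, hkK, hb22, hb00, hA, hB, -, -⟩ := exists_iwasawa_torusEntries_split (algebraMap L (w.1.adicCompletion L) δ) (coe_unit_placeForm_antidiag L w) n hn
  refine ⟨α₁, α₂, hA, hB, fun x => ?_⟩
  -- the `w`-component of `U(x)` is `Φ₃ · n(q)`, `q := ι_w(x|_v)`
  have hcomp : ((evalPlace (↥(maximalRealSubfield L)) L (IsCMField.complexConj L) 3 ((StdForm.antidiagonal 3).over L) v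
        (finPart (↥(maximalRealSubfield L)) L (IsCMField.complexConj L) 3 ((StdForm.antidiagonal 3).over L)
          ((quasiSplit (↥(maximalRealSubfield L)) L (IsCMField.complexConj L) 3).toAdelic (weylLongU ((IsCMField.complexConj L : L ≃ₐ[↥(maximalRealSubfield L)] L) : L →+* L) (rfl : (StdForm.antidiagonal 3).over L = (StdForm.antidiagonal 3).over L)) *
            ((heisChart hc (((((0 : InfiniteAdeleRing L)), quadraticFiniteAdeleMap ↥(maximalRealSubfield L) L δ (x 0, x 1)) : AdeleRing (𝓞 L) L),
              traceZeroLine ↥(maximalRealSubfield L) L (IsCMField.complexConj L) hcδ hδ ((0, x 2) : AdeleRing (𝓞 ↥(maximalRealSubfield L)) ↥(maximalRealSubfield L))) :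
                ↥(adelicUnipotent ↥(maximalRealSubfield L) L (IsCMField.complexConj L) 3)) : (quasiSplit (↥(maximalRealSubfield L)) L (IsCMField.complexConj L) 3).Adelic)) * b₁) :
        localPi L (IsCMField.complexConj L) 3 ((StdForm.antidiagonal 3).over L) v) : LocalGLPi L 3 v) w =
      (isUnit_placeForm_antidiag L w).unit * n (fun i => toPlace v w (x i v)) := by
    refine Units.ext ?_
    rw [coe_evalPlace_bigCell_of_evalPlace_eq_one L hc hcδ hδ v x b₁ w (hb₁ w), Units.val_mul, coe_unit_placeForm_antidiag, hn, Matrix.mul_fin_three]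
    simp only [zero_mul, one_mul, mul_zero, mul_one, zero_add, add_zero]
  -- the transported factors
  set β : localPi L (IsCMField.complexConj L) 3 ((StdForm.antidiagonal 3).over L) v :=
    (localPiSplitEquiv (IsCMField.complexConj L) ((StdForm.antidiagonal 3).over L) hc1 hJ w hw hJw).symm (b (fun i => toPlace v w (x i v))) with hβdef
  set κ : localPi L (IsCMField.complexConj L) 3 ((StdForm.antidiagonal 3).over L) v :=
    (localPiSplitEquiv (IsCMField.complexConj L) ((StdForm.antidiagonal 3).over L) hc1 hJ w hw hJw).symm (k (fun i => toPlace v w (x i v))) with hκdef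
  have hβw : ((β : localPi L (IsCMField.complexConj L) 3 ((StdForm.antidiagonal 3).over L) v) : LocalGLPi L 3 v) w = b (fun i => toPlace v w (x i v)) := by
    rw [hβdef, coe_localPiSplitEquiv_symm_apply, splitInv_apply_self]
  have hβw' : ((β : localPi L (IsCMField.complexConj L) 3 ((StdForm.antidiagonal 3).over L) v) : LocalGLPi L 3 v) (PlacesOver.galInv (IsCMField.complexConj L) w) =
      Matrix.GeneralLinearGroup.map (galAdicCompletionMap (IsCMField.complexConj L)⁻¹ (rfl : (IsCMField.complexConj L)⁻¹ • w.1 = (PlacesOver.galInv (IsCMField.complexConj L) w).1))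
        (splitHat w hJw.unit (b (fun i => toPlace v w (x i v)))) := by
    rw [hβdef, coe_localPiSplitEquiv_symm_apply, splitInv_apply_galInv (IsCMField.complexConj L) hc1 w hw]
  have hbBT : ((b (fun i => toPlace v w (x i v)) : GL (Fin 3) (w.1.adicCompletion L)) : Matrix (Fin 3) (Fin 3) (w.1.adicCompletion L)).BlockTriangular id :=
    (mem_standardParabolicGL_iff _ _).1 (hbB _)
  -- `β` is upper triangular at both places above `v`
  have hβB : ∀ w' : PlacesOver L v, ((((β : localPi L (IsCMField.complexConj L) 3 ((StdForm.antidiagonal 3).over L) v) : LocalGLPi L 3 v) w' : GL (Fin 3) (w'.1.adicCompletion L)) :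
      Matrix (Fin 3) (Fin 3) (w'.1.adicCompletion L)).BlockTriangular id := by
    intro w'
    rcases PlacesOver.eq_or_eq_galInv (IsCMField.complexConj L) hc1 w w' with rfl | rfl
    · rw [hβw]; exact hbBT
    · rw [hβw']
      intro i j hij
      rw [Matrix.GeneralLinearGroup.map_apply, blockTriangular_splitHat L w hbBT hij, map_zero]
  -- `κ ∈ U(𝒪_v)`: all its components are integral
  have hκint : κ ∈ localInt L (IsCMField.complexConj L) 3 ((StdForm.antidiagonal 3).over L) v :=
    (localPiSplitEquiv_symm_mem_localInt_iff (IsCMField.complexConj L) ((StdForm.antidiagonal 3).over L) hc1 hJ w hw hJw hJi _).2 (hkK _)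
  refine ⟨β, κ, fun w' => Units.mk0 _ (apply_diag_ne_zero_of_blockTriangular (hβB w') 0), hβB, fun w' => ?_, ?_, fun w' => Units.val_mk0 _, ?_, ?_⟩
  · -- level: `κ_{w'} ∈ GL₃(𝒪_{w'}) ≤ K_{w'}(1) = K_{w'}(|𝔫|_{w'})`
    rw [h𝔫 w']
    exact glInt_le_valuedCongruenceSubgroup_one L 3 w'.1 ((mem_localInt_iff L (IsCMField.complexConj L) 3 ((StdForm.antidiagonal 3).over L) v κ).1 hκint w')
  · -- the product: both sides have `w`-component `b·k = Φ₃·n(q)`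
    rw [hβdef, hκdef, ← map_mul, ← hbk, ← hcomp, ← localPiSplitEquiv_apply (IsCMField.complexConj L) ((StdForm.antidiagonal 3).over L) hc1 hJ w hw hJw,
      ContinuousMulEquiv.symm_apply_apply]
  · -- `t_w = α₂(q) = b₀₀`
    refine Units.ext ?_
    rw [Units.val_mk0, hβw, hb00]
  · -- `t_{c⁻¹w} = c⁻¹_*((b⁻¹)₂₂) = c⁻¹_*(b₂₂⁻¹) = c⁻¹_*(α₁(q))`
    rw [Units.val_mk0, hβw', Matrix.GeneralLinearGroup.map_apply, coe_splitHat_apply]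
    show galAdicCompletionMap (IsCMField.complexConj L)⁻¹ _ ((((b (fun i => toPlace v w (x i v)))⁻¹ : GL (Fin 3) (w.1.adicCompletion L)) : Matrix (Fin 3) (Fin 3) (w.1.adicCompletion L)) 2 2) = _
    rw [inv_apply_two_two_of_blockTriangular _ hbBT, hb22, Units.val_inv_eq_inv_val, inv_inv]

end Split

end Summit.HodgeConjecture.HodgeConjecture.Cruxes.H413.K2E1ChiGoodSplitReadingU3

end
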